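import Literature.Barriers.CriticalPhenomena.PlaquetteWalkHoleRootNotTopRow
import Literature.Barriers.CriticalPhenomena.PlaquetteWalkHoleRootRowLawNoKiss
import HarnessLib

/-!
# Barrier catalogue (SAWScalingLimit): wound class-`B2a` walks of limit cost `5` return to the ROOT ROW («B2a MEMBERS LIVE ON THE ROOT ROW», II)

`Z → ∞` limit model of the printed Yang–Baxter weights [GlazmanManolescu2019, §1, eq. (1)]; the «RECTANGLE COEFFICIENT» line of the venture lane «pcv-sawmu»
(b-engine-1 g26): FINDING-YB-LEVEL5-PHASE-LAW §3 RESULT 1 (in the census the class-`B2a` members of limit cost `5` occur ONLY at root-row rhombi) as a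
theorem. The limit cost is invariant under the row reflection (`cost_map_mirrorRow`: corner ↔ co-corner, slanted end ↔ slanted end), so the reflected walk
`ΩG.mirrorAt` (#WoundStraddle: still class `B2a`, still wound) turns `ΩG.not_top_row_of_cost_five` into ★★★ `ΩG.not_bottom_row_of_cost_five`; and
★★★★ `ΩG.rootRow_of_cost_five`: a wound class-`B2a` walk of limit cost `5` from the hole root `w.side W` at a rhombus `r` with `w.1 ≤ r.1` has `r.2 = w.2`
— the arc of `r` is a turn (then `r` is the unique middle isolated turn, which lies on the root row: the east chain of the first turn ends there) or a
straight horizontal cell whose west chain ends at a root-row turn, at `w`, or puts `r` on an extreme row, excluded by the two halves. COROLLARY: the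
ROOT-ROW LAW of `PlaquetteWalkHoleRootRowLawNoKiss` WITHOUT its row hypothesis — ★★★★★ `vertexFunctional_printed_zero_set_finite_of_wound_cost_five` /
`vertexFunctional_printed_exists_ne_zero_of_wound_cost_five`: at every rooted rhombus `f₀` with `w.1 ≤ f₀.1` carrying a wound class-`B2a` walk of limit cost
`5`, the zero set in `θ` of the printed-weight vertex functional is finite (so some `θ` has a non-vanishing functional).
[GlazmanManolescu2019 §1 Fig. 1, eq. (1), Lemma 2.1, Remark 2.2, §4.2 (lattice symmetries); Glazman2015WeightedSAW Lemma 3.1 (proof, pp. 6–7);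
CourantRobbins1958 Ch. V App. §2]
-/

noncomputable section

namespace Literature.Probability.RandomPlanarGeometry.SAW.YangBaxter

open Real
open Literature.Barriers.CriticalPhenomena.PlaquetteWalk

open private fc_fh fh_add_Mv three_le_Mv from Literature.Probability.RandomPlanarGeometry.YangBaxterSAWGeneralDomain

/-- **The limit cost is invariant under the row reflection** (the reflection exchanges the corner types `u₁ ↔ u₂` and the slanted end sides `N ↔ S`).
[cite: GlazmanManolescu2019, §1, Fig. 1, eq. (1); §4.2 (lattice symmetries)] -/
theorem cost_map_mirrorRow (c : ℤ) (l : List MidEdge) (s : Side) :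
    cost (slotOfSide (mirrorSide s)) (l.map (mirrorRow c)) = cost (slotOfSide s) l := by
  unfold cost
  rw [cfgCount_map_mirrorRow, cfgCount_map_mirrorRow]
  have hd : slotDeg (slotOfSide (mirrorSide s)) = slotDeg (slotOfSide s) := by cases s <;> rfl
  rw [hd]
  simp only [List.map_cons, List.map_nil, mirrorKind]
  omega

namespace ΩG

variable {D : Set Face} {w r : Face} {ω : ΩG D (w.side .W) r}

/-! ## The bottom row, by reflection -/

/-- ★★★ **NO RETURN TO THE BOTTOM ROW AT LIMIT COST `5`**: a wound class-`B2a` walk of limit cost `5` from the hole root `w.side W` (hole absent) at a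
rhombus `r` with `w.1 ≤ r.1` does not have `r` in its bottommost row — the row reflection of `not_top_row_of_cost_five`.
[cite: GlazmanManolescu2019, §1, Fig. 1 and eq. (1); Lemma 2.1; §4.2 (lattice symmetries)] [cite: Glazman2015WeightedSAW, Lemma 3.1 (proof, pp. 6–7)]
[cite: CourantRobbins1958, Ch. V Appendix §2 (the even–odd rule)] -/
theorem not_bottom_row_of_cost_five (hh : holeFaceW w ∉ D) (hr : RootedFace D (w.side .W) r) (h : ω.IsB2a)
    (hA : ω.AJ hr h (toC (midPt (w.side .W))) ≠ 0) (hc : cost (slotOfSide ω.1) ω.2.mids = 5) (hcol : w.1 ≤ r.1)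
    (hbot : ∀ j < ω.2.arcs.length, r.2 ≤ (ω.2.fc j).2) : False := by
  have hh' : holeFaceW w ∉ rowMirrorDom w D := by
    rw [mem_rowMirrorDom]
    have e : mirrorRowFace w.2 (holeFaceW w) = holeFaceW w := by
      simp only [mirrorRowFace, holeFaceW]; exact Prod.ext rfl (by simp only; ring)
    rw [e]; exact hh
  have hr' := rootedFace_rowMirrorDom_mirrorRowFace (w := w) hr
  have h' := isB2a_mirrorAt hr h
  have hA' := AJ_mirrorAt_ne_zero hr h hA
  have hc' : cost (slotOfSide ω.mirrorAt.1) ω.mirrorAt.2.mids = 5 := by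
    show cost (slotOfSide (mirrorSide ω.1)) (ω.2.mids.map (mirrorRow w.2)) = 5
    rw [cost_map_mirrorRow]; exact hc
  have hlen : ω.mirrorAt.2.arcs.length = ω.2.arcs.length := YBWalk.length_arcs_eq_of_mids_mirror ω.mirrorAt_mids
  refine not_top_row_of_cost_five (ω := ω.mirrorAt) hh' hr' h' hA' hc' hcol ?_
  intro j hj
  rw [hlen] at hj
  rw [YBWalk.fc_eq_of_mids_mirror ω.mirrorAt_mids hj]
  have := hbot j hj
  simp only [mirrorRowFace]
  omega

/-! ## B2a members live on the root row -/

/-- ★★★★ **B2a MEMBERS LIVE ON THE ROOT ROW**: a wound class-`B2a` walk of limit cost `5` from the hole root `w.side W` (hole absent) at a rhombus `r` of the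
root column or east of it returns to the root row: `r.2 = w.2`. If the arc of `r` turns, `r` is an isolated turn strictly between the extreme rows (the two
halves exclude the extreme rows), hence THE middle turn, which lies on the root row (the east chain of the first turn ends at a root-row isolated turn); if it
is straight it is horizontal (the end side of `r` is slanted and unused), and the west chain of `r` ends at an isolated turn of `r`'s row (again the middle
turn) or at `w`. [cite: GlazmanManolescu2019, §1, Fig. 1 and eq. (1); Lemma 2.1; Remark 2.2] [cite: Glazman2015WeightedSAW, Lemma 3.1 (proof, pp. 6–7)]
[cite: CourantRobbins1958, Ch. V Appendix §2 (the even–odd rule)] -/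
theorem rootRow_of_cost_five (hh : holeFaceW w ∉ D) (hr : RootedFace D (w.side .W) r) (h : ω.IsB2a)
    (hA : ω.AJ hr h (toC (midPt (w.side .W))) ≠ 0) (hc : cost (slotOfSide ω.1) ω.2.mids = 5) (hcol : w.1 ≤ r.1) : r.2 = w.2 := by
  classical
  by_contra hne
  set n := ω.2.arcs.length with hn
  have hz := end_slanted_of_cost_five hh hr h hA hc
  have hd : slotDeg (slotOfSide ω.1) = 1 := by rcases hz with e | e <;> rw [e] <;> rfl
  have hF := ω.fh_lt h
  have hlen : 0 < n := by omega
  have h0w : ω.2.fc 0 = w := fc_zero_eq_root w hh ω.2 hlen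
  have h0W : ω.2.sIn 0 = .W := YBWalk.sIn_zero_eq_W hh ω.2 hlen
  have h0E : ω.2.sIn 0 ≠ .E := by rw [h0W]; decide
  have hlast := sOut_last_NS_of_slanted h hz
  have hzE : ω.2.sOut (n - 1) ≠ .E := by rcases hlast with e | e <;> rw [e] <;> decide
  have hzW : ω.2.sOut (n - 1) ≠ .W := by rcases hlast with e | e <;> rw [e] <;> decide
  have hfcF := (fc_fh ω hr h).1
  have hsvr : ∀ l < n, ω.2.fc l = ω.2.fc ω.2.firstHitG → l = ω.2.firstHitG := fun l hl e => eq_firstHitG_of_fc_eq hr h hl e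
  have hfne3 : ω.2.firstHitG + 3 ≤ n := by have := three_le_Mv hr h; have := fh_add_Mv h; unfold ΩG.Mv at *; omega
  ---------------------------------------------------------------- the profile; `r` lies strictly between the extreme rows
  obtain ⟨Y₀, Y', hY'w, hY₀w, hY₀, hY', hprof, -⟩ := turn_profile_of_cost_five hh hr h hA hc
  have hrY₀ : r.2 ≠ Y₀ := fun e => not_top_row_of_cost_five hh hr h hA hc hcol (fun j hj => by rw [e]; exact hY₀ j hj)
  have hrY' : r.2 ≠ Y' := fun e => not_bottom_row_of_cost_five hh hr h hA hc hcol (fun j hj => by rw [e]; exact hY' j hj)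
  have hr₁ : Y' < r.2 := by have := hY' _ hF; rw [hfcF] at this; omega
  have hr₂ : r.2 < Y₀ := by have := hY₀ _ hF; rw [hfcF] at this; omega
  let P : Face → Prop := fun f => f ∈ facesL ω.2.mids ∧ (kindsL ω.2.mids f = [.corner] ∨ kindsL ω.2.mids f = [.coCorner])
  have hPiso : ∀ k < n, (∀ l < n, ω.2.fc l = ω.2.fc k → l = k) → arcKind (ω.2.sIn k) (ω.2.sOut k) ≠ .straight → P (ω.2.fc k) :=
    fun k hk hsv hkind => isolated_turn hk hsv hkind
  have hmid1 : ∀ f g, P f → P g → Y' < f.2 → f.2 < Y₀ → Y' < g.2 → g.2 < Y₀ → f = g := by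
    intro f g hf hg h1 h2 h3 h4
    by_contra hfg
    have := (hprof {f, g} (fun x hx => by
      simp only [Finset.mem_insert, Finset.mem_singleton] at hx
      rcases hx with rfl | rfl
      · exact hf
      · exact hg)).2.2 (fun x hx => by
      simp only [Finset.mem_insert, Finset.mem_singleton] at hx
      rcases hx with rfl | rfl
      · exact ⟨h1, h2⟩
      · exact ⟨h3, h4⟩)
    rw [Finset.card_insert_of_notMem (by simpa using hfg), Finset.card_singleton, hd] at this
    omega
  obtain ⟨X', -, hX', -⟩ := exists_right_entry_turn hh hr h
  obtain ⟨X, -, hX, -⟩ := exists_left_entry_turn hh hr h hA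
  ---------------------------------------------------------------- the middle turn `τ` lies on the root row (east chain of the first turn)
  obtain ⟨k₁, hk₁, hstr, hturn⟩ := exists_first_turn_of_wound hh hr h hA hc
  obtain ⟨hrun, -⟩ := ω.2.initial_run hh hk₁ hstr
  obtain ⟨hfk, hWk⟩ := hrun k₁ le_rfl
  have hp₁W : ω.2.UsesSide (w.1 + k₁, w.2) .W := ⟨k₁, hk₁, hfk, Or.inl hWk⟩
  obtain ⟨τ1, hPτ⟩ : ∃ τ1 : ℤ, P (τ1, w.2) := by
    by_cases hpE : ω.2.UsesSide (w.1 + k₁, w.2) .E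
    · obtain ⟨M, hWall, -, hend⟩ := ω.2.chain_E hX' hpE
      rcases hend with ⟨hM1, hnot⟩ | ⟨-, hs0⟩ | ⟨-, hsZ⟩
      · obtain ⟨i', hi', hfc', hsv', -, -, -, hk'⟩ := ω.2.isolated_of_usesSide_not_opp (hWall M hM1 le_rfl) hnot
        refine ⟨w.1 + k₁ + M, ?_⟩
        have := hPiso i' hi' hsv' hk'; rw [hfc'] at this; exact this
      · exact absurd hs0 h0E
      · exact absurd hsZ hzE
    · obtain ⟨i', hi', hfc', hsv', -, -, -, hk'⟩ := ω.2.isolated_of_usesSide_not_opp hp₁W hpE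
      refine ⟨w.1 + k₁, ?_⟩
      have := hPiso i' hi' hsv' hk'; rw [hfc'] at this; exact this
  ---------------------------------------------------------------- the arc of `r`
  by_cases hk : arcKind (ω.2.sIn ω.2.firstHitG) (ω.2.sOut ω.2.firstHitG) = .straight
  · -- straight: not vertical (the end side of `r` is `N` or `S` and unused), so `r` uses `W`
    have hrside : ∀ s, ω.2.UsesSide r s → r.side s ≠ r.side ω.1 := by
      rintro s ⟨l, hl, hfl, hs⟩ e
      have hl' := hsvr l hl (hfl.trans hfcF.symm)
      obtain ⟨hin, hout⟩ := ω.2.side_sIn_eq_nth hl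
      rw [hfl] at hin hout
      rw [← ω.2.nth_length] at e
      rcases hs with hs | hs
      · rw [hs] at hin; have := ω.2.nth_inj (show l ≤ n by omega) le_rfl (hin.symm.trans e).symm.symm; omega
      · rw [hs] at hout; have := ω.2.nth_inj (show l + 1 ≤ n by omega) le_rfl (hout.symm.trans e).symm.symm; omega
    have hout := ω.2.sOut_of_straight hF hk
    have hrW : ω.2.UsesSide r .W := by
      have hN : ¬(ω.2.UsesSide r .N ∧ ω.2.UsesSide r .S) := by
        rintro ⟨h1, h2⟩
        rcases hz with e | e
        · exact hrside .N h1 (by rw [e])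
        · exact hrside .S h2 (by rw [e])
      have key : ω.2.sIn ω.2.firstHitG = .W ∨ ω.2.sOut ω.2.firstHitG = .W ∨
          ((ω.2.sIn ω.2.firstHitG = .N ∨ ω.2.sOut ω.2.firstHitG = .N) ∧ (ω.2.sIn ω.2.firstHitG = .S ∨ ω.2.sOut ω.2.firstHitG = .S)) := by
        revert hout; cases ω.2.sIn ω.2.firstHitG <;> cases ω.2.sOut ω.2.firstHitG <;> decide
      rcases key with e | e | ⟨hN', hS'⟩
      · exact ⟨_, hF, hfcF, Or.inl e⟩
      · exact ⟨_, hF, hfcF, Or.inr e⟩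
      · exact absurd ⟨⟨_, hF, hfcF, hN'⟩, ⟨_, hF, hfcF, hS'⟩⟩ hN
    obtain ⟨M, hEall, -, hend⟩ := ω.2.chain_W hX hrW
    rcases hend with ⟨hM1, hnot⟩ | ⟨hA0, -⟩ | ⟨-, hsZ⟩
    · obtain ⟨i', hi', hfc', hsv', -, -, -, hk'⟩ := ω.2.isolated_of_usesSide_not_opp (hEall M hM1 le_rfl) hnot
      have hP' : P (r.1 - M, r.2) := by rw [← hfc']; exact hPiso i' hi' hsv' hk'
      have := hmid1 _ _ hP' hPτ hr₁ hr₂ hY'w hY₀w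
      have := congrArg Prod.snd this; simp only at this; exact hne this
    · rw [h0w] at hA0; have := congrArg Prod.snd hA0; simp only at this; omega
    · exact absurd hsZ hzW
  · -- a turn: `r` is an isolated turn strictly between the extreme rows, hence the middle turn
    have hPr : P r := by have := hPiso _ hF hsvr hk; rwa [hfcF] at this
    have := hmid1 _ _ hPr hPτ hr₁ hr₂ hY'w hY₀w
    exact hne (by rw [this])

end ΩG

end Literature.Probability.RandomPlanarGeometry.SAW.YangBaxter

namespace Literature.Barriers.CriticalPhenomena.PlaquetteWalk

open Literature.Probability.RandomPlanarGeometry.SAW.YangBaxter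
open Real

variable (Dl : List Face)

/-! ## The root-row law without its row hypothesis -/

open Classical in
/-- ★★★★★ **THE ROOT-ROW LAW, ROW-FREE.** Let `a = w.side W` be a `W`-normalised hole root of the finite domain `dom Dl` (hole absent) and `f₀` a rooted rhombus
with `w.1 ≤ f₀.1` carrying a wound class-`B2a` walk of limit cost `5`. Then `f₀` lies on the root row (`ΩG.rootRow_of_cost_five`), so the zero set in
`θ ∈ (0, π)` of the printed-weight vertex functional at `f₀` is finite, with at most `4·maxExp − 4` zeros (`vertexFunctional_printed_zero_set_finite_of_rootRow`).
[cite: GlazmanManolescu2019, §1, eq. (1) and Fig. 1; Lemma 2.1, eq. (CR); Remark 2.2] [cite: Glazman2015WeightedSAW, Lemma 3.1 (proof, pp. 6–7)]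
[cite: CourantRobbins1958, Ch. V Appendix §2 (the even–odd rule)] -/
theorem vertexFunctional_printed_zero_set_finite_of_wound_cost_five {w f₀ : Face} (hh : holeFaceW w ∉ dom Dl)
    (hr : RootedFace (dom Dl) (w.side .W) f₀) (hcol : w.1 ≤ f₀.1)
    (hex : ∃ (ω : ΩG (dom Dl) (w.side .W) f₀) (h : ω.IsB2a), ω.AJ hr h (toC (midPt (w.side .W))) ≠ 0 ∧
      cost (slotOfSide ω.1) ω.2.mids = 5) :
    {θ ∈ Set.Ioo 0 π | vertexFunctional (printedWeights θ) tFiveEighths (ybCoeff θ) Dl (w.side .W) f₀ = 0}.Finite ∧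
      {θ ∈ Set.Ioo 0 π | vertexFunctional (printedWeights θ) tFiveEighths (ybCoeff θ) Dl (w.side .W) f₀ = 0}.ncard ≤
        4 * maxExp Dl (w.side .W) f₀ + 1 - 5 := by
  obtain ⟨ω, h, hA, hc⟩ := hex
  exact vertexFunctional_printed_zero_set_finite_of_rootRow Dl hh hr (ΩG.rootRow_of_cost_five hh hr h hA hc hcol) hcol ⟨ω, h, hA, hc⟩

/-- ★★★★★ **Hence some `θ ∈ (0, π)` has a NON-VANISHING printed-weight vertex functional at every such rhombus.**
[cite: GlazmanManolescu2019, §1, eq. (1); Lemma 2.1, eq. (CR); Remark 2.2] [cite: Glazman2015WeightedSAW, Lemma 3.1 (proof, pp. 6–7)] -/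
theorem vertexFunctional_printed_exists_ne_zero_of_wound_cost_five {w f₀ : Face} (hh : holeFaceW w ∉ dom Dl)
    (hr : RootedFace (dom Dl) (w.side .W) f₀) (hcol : w.1 ≤ f₀.1)
    (hex : ∃ (ω : ΩG (dom Dl) (w.side .W) f₀) (h : ω.IsB2a), ω.AJ hr h (toC (midPt (w.side .W))) ≠ 0 ∧
      cost (slotOfSide ω.1) ω.2.mids = 5) :
    ∃ θ ∈ Set.Ioo 0 π, vertexFunctional (printedWeights θ) tFiveEighths (ybCoeff θ) Dl (w.side .W) f₀ ≠ 0 := by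
  obtain ⟨ω, h, hA, hc⟩ := hex
  exact vertexFunctional_printed_exists_ne_zero_of_rootRow Dl hh hr (ΩG.rootRow_of_cost_five hh hr h hA hc hcol) hcol ⟨ω, h, hA, hc⟩

end Literature.Barriers.CriticalPhenomena.PlaquetteWalk
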